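import Literature.AnabelianGeometry.EtaleTheta.Discharge.Sec5OfConnectedTemperoid
import Literature.AnabelianGeometry.SemiGraphs.BTempQDPairCategoryPNonVacuity

/-!
# [EtTh] Def. 3.6 (iii) / Lemma 5.8: the constants `K^× ↪ O^×(B_N^birat)` pulled back from the base curve are
# `Aut_C(B_N)`-fixed — the §5 binder `hconst` DISCHARGED for the terminal-object shape of `constEmb` (§3 p.302–304, §5
# p.330–331 / PDF pp.76–78, 104–105)

Mochizuki, *The étale theta function and its Frobenioid-theoretic manifestations*, Publ. RIMS **45** (2009)
[cite: MochizukiEtTh2009, Def 3.6 (iii) p.303 (PDF p.77); Lem 5.8 p.331 (PDF p.105)].  abc-iut cell, cross-layer piece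
by signature for layer L2 (seat abc-iut-w4-d008, gen 4); closes GAP-LEDGER row **G-L2t4-3** (binder `hconst` of
abc-iut-L2-t4's `ThetaFrobenioid.biratAutAction_ofConnectedTemperoidData` / `facts_ofConnectedTemperoidData`,
`Discharge/Sec5OfConnectedTemperoid.lean`) for the CANONICAL shape of the constant embedding, and the binder `hnat`
(naturality of the constants along `β_{1,N}`) of abc-iut-L2-d4's Thm. 5.7 census.  PROOF-ONLY, additive, 0 definitions.

WHAT IS PROVED.  In §5 (p.330, PDF p.104) every object `A_N, B_N, …` of the tempered Frobenioid `C` lies over the base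
curve `X^log` (`K = K̈`, p.322), and "the natural inclusion `K^× ↪ O^×(B_N^birat)`" of Lemma 5.8 (p.331) is the pull-back of
the constant rational functions of `X` to `B_N`.  In the tree's vocabulary (abc-iut-L2-t9 `TemperedFrobenioid.biratUnitsModel A
:= B(A_D)^×`, `biratAutModel A σ = B(Base(σ⁻¹))^*`, `BiKummerOfModel.lean`): for ANY tempered Frobenioid
`C : TemperedFrobenioid T D VD`, ANY object `X₀` of the base category `D` receiving AT MOST ONE arrow from each object
(e.g. a terminal object; for the genuine connected base `D = B^temp(Π^tp_X)⁰` of abc-iut-L2-t4's `Sec5OfConnectedTemperoid`: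
the one-point `Π^tp_X`-set, i.e. `X` itself — `ConnectedPunit.subsingleton_hom`, `ConnectedPunit.nonempty_isTerminal` below),
ANY arrow `t : A_D → X₀` and ANY homomorphism `c₀ : K'ˣ →* B(X₀)^×` ("the constants, as rational functions on `X`"), the
embedding

  `constEmb := B(t)^× ∘ c₀ : K'ˣ →* B(A_D)^× = O^×(A^birat)`

satisfies `hconst`: **`C.biratAutModel A e (constEmb k) = constEmb k` for EVERY `e ∈ Aut_C(A)`**
(`biratAutModel_unitsMap_comp_apply_of_subsingleton`, `…_of_isTerminal`) — because `Base(e⁻¹) ≫ t = t` and `B` is a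
functor.  NO property of `C`, no `Prop34Cnst`, no genuine instance is used: the binder is STRUCTURAL for this shape (it
was classed "(A) GENUINE-INSTANCE-ONLY" in the Thm. 5.7 binder census of 2026-08-26T07:25Z).  The same two lines give
**`hnat`**: `B(Base(φ))(constEmb_A k) = constEmb_{A'} k` for every `φ : A' → A` of `C`
(`ratFnFunctor_map_unitsMap_comp_of_subsingleton`), in the exact shape of the `hnat` binder of
`ThetaFrobenioidTower.thetaRootPreservedAll_ofConnectedTemperoidYddFamily` (p430430).  Finally
`ThetaFrobenioid.facts_ofConnectedTemperoidData_ofSubsingleton` re-assembles abc-iut-L2-t4's `Facts` bundle with `hconst`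
DISCHARGED: residual inputs `hH` (a theorem at `A_⊙^bs := Ÿ`, `hH_mkOfConnectedTemperoidYdd` — whence
`facts_ofConnectedTemperoidYddData_ofSubsingleton`: `Facts` from `hgc` ALONE) and `hgc` (Lemma 5.8's geometric
connectedness, G-L2t4-4) plus the DATA `X₀, t, c₀` and the injectivity of the composite (transferred from `c₀` and `B(t)`
by `unitsMap_comp_injective`; injectivity of pull-backs of `B₀^Λ` is not a field of the abstract data).
HONEST FRAMING: kernel-checked functoriality over abc-iut-L2-t3's / abc-iut-L2-t9's / abc-iut-L3's data structures;
nothing of [EtTh] §5 is asserted beyond these implications; no side taken on anything downstream ([IUTchIII] Cor. 3.12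
untouched); typed ≠ proved.
-/

noncomputable section

namespace Literature.AnabelianGeometry.EtaleTheta

open CategoryTheory CategoryTheory.Limits Opposite Literature.AlgebraicGeometry.Frobenioids
  Literature.AnabelianGeometry.SemiGraphs

universe u₀ v₀ u v w

/-! ## Functoriality of `B` into an object with at most one arrow from each object -/

namespace TemperedFrobenioid

variable {D₀ : Type u₀} [Category.{v₀} D₀] {V : FrdIMonoidStub.{w}}
  {T : RealifiedDivisorMonoids (D₀ := D₀) V} {D : Type u} [Category.{v} D]
  {VD : FrdICatStub.{u, v, w} D} (C : TemperedFrobenioid T D VD)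

/-- `B(g)(B(t)(f)) = B(g ≫ t)(f)`: the rational-function monoid `B` of a tempered Frobenioid is a functor (Def. 3.6 (ii),
p.303 (PDF p.77): "`B := B₀^Λ|_D ×_{(Φ^{ℝ-log})^gp} Φ^gp`", a monoid on `D`).  [cite: MochizukiEtTh2009, Def 3.6 p.303 (PDF p.77)] -/
theorem ratFnFunctor_map_apply_map_apply {X₀ Y Y' : D} (t : Y ⟶ X₀) (g : Y' ⟶ Y)
    (f : C.ratFnFunctor.obj (op X₀)) :
    (C.ratFnFunctor.map g.op).hom ((C.ratFnFunctor.map t.op).hom f) = (C.ratFnFunctor.map (g ≫ t).op).hom f := by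
  rw [op_comp, C.ratFnFunctor.map_comp, CommMonCat.comp_apply]

/-- If `X₀ ∈ Ob(D)` receives at most one arrow from `Y'`, then pulling `f ∈ B(X₀)` back to `Y` along `t` and further along
any `g : Y' → Y` gives the pull-back of `f` along THE arrow `t' : Y' → X₀` (for `D = B^temp(Π^tp_X)⁰` and `X₀ = X`: a rational
function of `X` read on a covering does not depend on the factorisation through intermediate coverings).
[cite: MochizukiEtTh2009, Def 3.6 p.303 (PDF p.77)] -/
theorem ratFnFunctor_map_apply_map_apply_of_subsingleton {X₀ Y Y' : D} [Subsingleton (Y' ⟶ X₀)] (t : Y ⟶ X₀)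
    (t' : Y' ⟶ X₀) (g : Y' ⟶ Y) (f : C.ratFnFunctor.obj (op X₀)) :
    (C.ratFnFunctor.map g.op).hom ((C.ratFnFunctor.map t.op).hom f) = (C.ratFnFunctor.map t'.op).hom f := by
  rw [ratFnFunctor_map_apply_map_apply, Subsingleton.elim (g ≫ t) t']

/-- Terminal-object form of `ratFnFunctor_map_apply_map_apply_of_subsingleton`.
[cite: MochizukiEtTh2009, Def 3.6 p.303 (PDF p.77)] -/
theorem ratFnFunctor_map_apply_map_apply_of_isTerminal {X₀ Y Y' : D} (hX₀ : IsTerminal X₀) (g : Y' ⟶ Y)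
    (f : C.ratFnFunctor.obj (op X₀)) :
    (C.ratFnFunctor.map g.op).hom ((C.ratFnFunctor.map (hX₀.from Y).op).hom f) =
      (C.ratFnFunctor.map (hX₀.from Y').op).hom f := by
  rw [ratFnFunctor_map_apply_map_apply, hX₀.hom_ext (g ≫ hX₀.from Y) (hX₀.from Y')]

/-! ## `hconst`: constants pulled back from `X₀` are `Aut_C(A)`-fixed (Def. 3.6 (iii); Lemma 5.8's `K^× ↪ O^×(B_N^birat)`) -/

/-- **Def. 3.6 (iii) / Lemma 5.8, structural form.**  For an object `A` of the tempered Frobenioid whose base `A_D` admits at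
most one arrow to `X₀`, every unit `f ∈ B(X₀)^×` pulled back along `t : A_D → X₀` to `O^×(A^birat) = B(A_D)^×` is FIXED by
the natural action of every `e ∈ Aut_C(A)` (`biratAutModel A e = B(Base(e⁻¹))^*`, Def. 4.1 (iii) p.313): `Base(e⁻¹) ≫ t = t`.
[cite: MochizukiEtTh2009, Def 3.6 (iii) p.303 (PDF p.77); Lem 5.8 p.331 (PDF p.105)] -/
theorem biratAutModel_unitsMap_apply_of_subsingleton {X₀ : D} (A : C.category) [Subsingleton (A.base ⟶ X₀)]
    (t : A.base ⟶ X₀) (e : Aut A) (f : (C.ratFnFunctor.obj (op X₀))ˣ) :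
    C.biratAutModel A e (Units.map (C.ratFnFunctor.map t.op).hom f) = Units.map (C.ratFnFunctor.map t.op).hom f := by
  ext
  rw [coe_biratAutModel_apply, Units.coe_map]
  exact C.ratFnFunctor_map_apply_map_apply_of_subsingleton t t (ModelFrobenioid.baseMap e.inv) f

/-- **`hconst` for the constant embedding `constEmb := B(t)^× ∘ c₀`** (any `c₀ : K'ˣ →* B(X₀)^×`, "the constants as rational
functions on `X`"; `t : A_D → X₀` with `X₀` receiving at most one arrow from `A_D`): `e · constEmb(k) = constEmb(k)` for every
`e ∈ Aut_C(A)` — the binder `hconst` of `ThetaFrobenioid.biratAutAction_ofConnectedTemperoidData` /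
`facts_ofConnectedTemperoidData` (GAP row G-L2t4-3) in exactly its shape.  [cite: MochizukiEtTh2009, Def 3.6 (iii) p.303 (PDF p.77); Lem 5.8 p.331 (PDF p.105)] -/
theorem biratAutModel_unitsMap_comp_apply_of_subsingleton {X₀ : D} (A : C.category) [Subsingleton (A.base ⟶ X₀)]
    (t : A.base ⟶ X₀) {K' : Type*} [Monoid K'] (c₀ : K' →* (C.ratFnFunctor.obj (op X₀))ˣ) :
    ∀ (e : Aut A) (k : K'),
      C.biratAutModel A e (((Units.map (C.ratFnFunctor.map t.op).hom).comp c₀) k) =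
        ((Units.map (C.ratFnFunctor.map t.op).hom).comp c₀) k :=
  fun e k => C.biratAutModel_unitsMap_apply_of_subsingleton A t e (c₀ k)

/-- Terminal-object form of `hconst`: with `t := (X₀ terminal).from A_D`.
[cite: MochizukiEtTh2009, Def 3.6 (iii) p.303 (PDF p.77); Lem 5.8 p.331 (PDF p.105)] -/
theorem biratAutModel_unitsMap_comp_apply_of_isTerminal {X₀ : D} (hX₀ : IsTerminal X₀) (A : C.category)
    {K' : Type*} [Monoid K'] (c₀ : K' →* (C.ratFnFunctor.obj (op X₀))ˣ) :
    ∀ (e : Aut A) (k : K'),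
      C.biratAutModel A e (((Units.map (C.ratFnFunctor.map (hX₀.from A.base).op).hom).comp c₀) k) =
        ((Units.map (C.ratFnFunctor.map (hX₀.from A.base).op).hom).comp c₀) k :=
  haveI : Subsingleton (A.base ⟶ X₀) := ⟨hX₀.hom_ext⟩
  C.biratAutModel_unitsMap_comp_apply_of_subsingleton A (hX₀.from A.base) c₀

/-! ## `hnat`: the constants are natural along every morphism of `C` -/

/-- **`hnat`, structural form.**  For a morphism `φ : A' → A` of the tempered Frobenioid and constant embeddings of the shape
`constEmb_A := B(t)^× ∘ c₀`, `constEmb_{A'} := B(t')^× ∘ c₀` through arrows `t : A_D → X₀`, `t' : A'_D → X₀` into an object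
receiving at most one arrow from `A'_D`: `B(Base(φ))(constEmb_A k) = constEmb_{A'} k` — the binder `hnat` ("`constEmb_N =
B(β_{1,N}) ∘ constEmb_1`") of `ThetaFrobenioidTower.thetaRootPreservedAll_ofConnectedTemperoidYddFamily` in its shape
(coercions to `B(−)`).  [cite: MochizukiEtTh2009, Lem 5.8 p.331 (PDF p.105)] -/
theorem ratFnFunctor_map_unitsMap_comp_of_subsingleton {X₀ : D} {A A' : C.category} [Subsingleton (A'.base ⟶ X₀)]
    (t : A.base ⟶ X₀) (t' : A'.base ⟶ X₀) (φ : A' ⟶ A) {K' : Type*} [Monoid K']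
    (c₀ : K' →* (C.ratFnFunctor.obj (op X₀))ˣ) (k : K') :
    (C.ratFnFunctor.map (ModelFrobenioid.baseMap φ).op).hom
        ((((Units.map (C.ratFnFunctor.map t.op).hom).comp c₀) k : (C.ratFnFunctor.obj (op A.base))ˣ) :
          C.ratFnFunctor.obj (op A.base)) =
      ((((Units.map (C.ratFnFunctor.map t'.op).hom).comp c₀) k : (C.ratFnFunctor.obj (op A'.base))ˣ) :
        C.ratFnFunctor.obj (op A'.base)) := by
  rw [MonoidHom.comp_apply, MonoidHom.comp_apply, Units.coe_map, Units.coe_map]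
  exact C.ratFnFunctor_map_apply_map_apply_of_subsingleton t t' (ModelFrobenioid.baseMap φ) (c₀ k)

/-- Terminal-object form of `hnat`.  [cite: MochizukiEtTh2009, Lem 5.8 p.331 (PDF p.105)] -/
theorem ratFnFunctor_map_unitsMap_comp_of_isTerminal {X₀ : D} (hX₀ : IsTerminal X₀) {A A' : C.category} (φ : A' ⟶ A)
    {K' : Type*} [Monoid K'] (c₀ : K' →* (C.ratFnFunctor.obj (op X₀))ˣ) (k : K') :
    (C.ratFnFunctor.map (ModelFrobenioid.baseMap φ).op).hom
        ((((Units.map (C.ratFnFunctor.map (hX₀.from A.base).op).hom).comp c₀) k :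
          (C.ratFnFunctor.obj (op A.base))ˣ) : C.ratFnFunctor.obj (op A.base)) =
      ((((Units.map (C.ratFnFunctor.map (hX₀.from A'.base).op).hom).comp c₀) k :
        (C.ratFnFunctor.obj (op A'.base))ˣ) : C.ratFnFunctor.obj (op A'.base)) :=
  haveI : Subsingleton (A'.base ⟶ X₀) := ⟨hX₀.hom_ext⟩
  C.ratFnFunctor_map_unitsMap_comp_of_subsingleton (hX₀.from A.base) (hX₀.from A'.base) φ c₀ k

/-! ## Injectivity transfer for `constEmb := B(t)^× ∘ c₀` -/

/-- The constant embedding `B(t)^× ∘ c₀` is injective as soon as `c₀` is and the pull-back `B(t) : B(X₀) → B(A_D)` is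
(the latter is NOT a consequence of the abstract Def. 3.6 (i) data, which carry no injectivity of pull-backs of `B₀^Λ`; in
print it holds because rational functions restrict injectively to coverings).  [cite: MochizukiEtTh2009, Lem 5.8 p.331 (PDF p.105)] -/
theorem unitsMap_comp_injective {X₀ Y : D} (t : Y ⟶ X₀) {K' : Type*} [Monoid K']
    {c₀ : K' →* (C.ratFnFunctor.obj (op X₀))ˣ} (hc₀ : Function.Injective c₀)
    (ht : Function.Injective (C.ratFnFunctor.map t.op).hom) :
    Function.Injective ((Units.map (C.ratFnFunctor.map t.op).hom).comp c₀) :=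
  (Units.map_injective ht).comp hc₀

end TemperedFrobenioid

/-! ## The base curve `X` as the one-point object of `B^temp(Π^tp_X)⁰`: at most one arrow from every object, terminal

The one-point `Π`-set is a connected object of `B^temp(Π)` (`QDPair.isConnectedObj_punitObj`, [SemiAnbd] Thm. A.4 proof), so it
is an object of `B^temp(Π)⁰` — the base curve `X` itself among its connected tempered coverings. -/

namespace ConnectedPunit

variable {G : Type u} [Group G] [TopologicalSpace G]

/-- Every object of `B^temp(Π)⁰` admits AT MOST ONE arrow to the one-point object (two arrows agree on points).
[cite: MochizukiSemiAnbd2006, Thm A.4 pp.82-86] -/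
theorem subsingleton_hom (Y : ConnectedPart (BTemp G)) :
    Subsingleton (Y ⟶ (⟨BTemp.punitObj, QDPair.isConnectedObj_punitObj⟩ : ConnectedPart (BTemp G))) :=
  ⟨fun f g => ObjectProperty.hom_ext _ (BTemp.isTerminal_punitObj.hom_ext f.hom g.hom)⟩

/-- Every object of `B^temp(Π)⁰` admits an arrow to the one-point object.  [cite: MochizukiSemiAnbd2006, Thm A.4 pp.82-86] -/
theorem nonempty_hom (Y : ConnectedPart (BTemp G)) :
    Nonempty (Y ⟶ (⟨BTemp.punitObj, QDPair.isConnectedObj_punitObj⟩ : ConnectedPart (BTemp G))) :=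
  ⟨ObjectProperty.homMk (BTemp.isTerminal_punitObj.from Y.obj)⟩

/-- The one-point object is TERMINAL in `B^temp(Π)⁰` (as it is in `B^temp(Π)`, `BTemp.isTerminal_punitObj`).
[cite: MochizukiSemiAnbd2006, Thm A.4 pp.82-86] -/
theorem nonempty_isTerminal :
    Nonempty (IsTerminal (⟨BTemp.punitObj, QDPair.isConnectedObj_punitObj⟩ : ConnectedPart (BTemp G))) :=
  ⟨IsTerminal.ofUniqueHom (fun Y => ObjectProperty.homMk (BTemp.isTerminal_punitObj.from Y.obj))
    fun Y m => (subsingleton_hom Y).elim m _⟩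

end ConnectedPunit

/-! ## The §5 `Facts` bundle over `B^temp(Π^tp_X)⁰` with `hconst` discharged -/

namespace ThetaFrobenioid

section General

variable {K : Type u₀} [Field K] {X : SemiGraphs.TemperedArithmeticGroup.{u₀} K} {D₀ : Type u₀} [Category.{v₀} D₀]
  {V : FrdIMonoidStub.{w}} {T₀ : RealifiedDivisorMonoids (D₀ := D₀) V}
  {VD : FrdICatStub.{u₀ + 1, u₀, w} (ConnectedPart (BTemp X.Pi))}
  {tf : TemperedFrobenioid T₀ (ConnectedPart (BTemp X.Pi)) VD} {hZ : tf.monoidType = MonoidType.Z}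
  {hP : ∀ A : (ConnectedPart (BTemp X.Pi))ᵒᵖ, IsPerfect (tf.Φ.carrier A)}
  {NH : Subgroup (Field.absoluteGaloisGroup K) → tf.category → ℕ+ → Prop} {A₀ : tf.category}
  {hA₀ : PreFrobenioid.IsFrobeniusTrivial tf.toElem A₀} {hA₀' : SemiGraphs.IsGaloisObj A₀.base.obj}
  {pullFrac : ∀ {A A' : (BiKummerSetting.mkOfConnectedTemperoid X tf hZ hP NH A₀ hA₀ hA₀').C} (_ : A' ⟶ A),
    (BiKummerSetting.mkOfConnectedTemperoid X tf hZ hP NH A₀ hA₀ hA₀').biratUnits A →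
      (BiKummerSetting.mkOfConnectedTemperoid X tf hZ hP NH A₀ hA₀ hA₀').biratUnits A'}
  {lv N : ℕ+} {T : ThetaEnvData.{max u₀ w} N}
  {θ : (BiKummerSetting.mkOfConnectedTemperoid X tf hZ hP NH A₀ hA₀ hA₀').biratUnits
    (BiKummerSetting.mkOfConnectedTemperoid X tf hZ hP NH A₀ hA₀ hA₀').Aodot}
  {Bl : (BiKummerSetting.mkOfConnectedTemperoid X tf hZ hP NH A₀ hA₀ hA₀').C}
  {Pl : (BiKummerSetting.mkOfConnectedTemperoid X tf hZ hP NH A₀ hA₀ hA₀').FractionPair θ Bl}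
  {Rl : (BiKummerSetting.mkOfConnectedTemperoid X tf hZ hP NH A₀ hA₀ hA₀').NthRoot θ Pl lv pullFrac}
  (h : ModelFrobenioid.Hypotheses tf.divisorMonoid tf.ratFnFunctor)
  (Q : FrobenioidTheta.ThetaSubquotientStub.{w} (ConnectedPart (BTemp X.Pi))) (odd_l : Odd (lv : ℕ))
  (R : (BiKummerSetting.mkOfConnectedTemperoid X tf hZ hP NH A₀ hA₀ hA₀').NthRoot Rl.root Rl.pair N pullFrac)
  (ιX : T.PiX ≃ₜ* X.Pi) (K' : Type w) [Field K']
  {X₀ : ConnectedPart (BTemp X.Pi)} [Subsingleton (R.BN.base ⟶ X₀)] (t : R.BN.base ⟶ X₀)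
  (c₀ : K'ˣ →* (tf.ratFnFunctor.obj (op X₀))ˣ)
  (hinj : Function.Injective ((Units.map (tf.ratFnFunctor.map t.op).hom).comp c₀))
  (hinvc : ∀ g : Aut R.AN.base,
    pull tf.divisorMonoid g.hom (ModelFrobenioid.div R.pair.num) = ModelFrobenioid.div R.pair.num)
  (hinvp : ∀ y : T.PiX, y ∈ T.PiYdd →
    pull tf.divisorMonoid ((BiKummerSetting.mkOfConnectedTemperoid X tf hZ hP NH A₀ hA₀ hA₀').galoisSurj R.AN.base
      R.αData.isGalois (ιX y)).hom (ModelFrobenioid.div R.pair.den) = ModelFrobenioid.div R.pair.den)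

/-- **`Facts` for the [EtTh] §5 data over the genuine connected base `B^temp(Π^tp_X)⁰` with the constants PULLED BACK FROM
`X₀`** (`constEmb := B(t)^× ∘ c₀`, `t : (B_N)_D → X₀` into an object receiving at most one arrow from `(B_N)_D` — the base
curve `X` as the one-point object, `ConnectedPunit.subsingleton_hom`): abc-iut-L2-t4's `facts_ofConnectedTemperoidData`
with the binder `hconst` (Def. 3.6 (iii), GAP row G-L2t4-3) DISCHARGED by `biratAutModel_unitsMap_comp_apply_of_subsingleton`.
Residual inputs: `hH` (`Π^tp_Ÿ ⊆ H_⊙`; a theorem for `A_⊙^bs := Ÿ`), `hgc` (Lemma 5.8's geometric connectedness, G-L2t4-4),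
the data `X₀, t, c₀` and the injectivity `hinj` of the composite.
[cite: MochizukiEtTh2009, §5 p.330–331 (PDF pp.104–105); Def 3.6 (iii) p.303 (PDF p.77); Lem 5.8 p.331 (PDF p.105)] -/
theorem facts_ofConnectedTemperoidData_ofSubsingleton
    (hH : ∀ y : T.PiX, y ∈ T.PiYdd → ιX y ∈ (BiKummerSetting.mkOfConnectedTemperoid X tf hZ hP NH A₀ hA₀ hA₀').Hodot)
    (hgc : ∀ u : (ofConnectedTemperoidData h Q odd_l R ιX K' ((Units.map (tf.ratFnFunctor.map t.op).hom).comp c₀) hinj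
          hinvc hinvp).units
        (ofConnectedTemperoidData h Q odd_l R ιX K' ((Units.map (tf.ratFnFunctor.map t.op).hom).comp c₀) hinj
          hinvc hinvp).BN,
      (∀ y ∈ (ofConnectedTemperoidData h Q odd_l R ιX K' ((Units.map (tf.ratFnFunctor.map t.op).hom).comp c₀) hinj
          hinvc hinvp).imPiY,
        (ofConnectedTemperoidData h Q odd_l R ιX K' ((Units.map (tf.ratFnFunctor.map t.op).hom).comp c₀) hinj
            hinvc hinvp).sgpCap y *
          (u : Aut (ofConnectedTemperoidData h Q odd_l R ιX K' ((Units.map (tf.ratFnFunctor.map t.op).hom).comp c₀)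
            hinj hinvc hinvp).BN) *
          ((ofConnectedTemperoidData h Q odd_l R ιX K' ((Units.map (tf.ratFnFunctor.map t.op).hom).comp c₀) hinj
            hinvc hinvp).sgpCap y)⁻¹ = u) →
      (ofConnectedTemperoidData h Q odd_l R ιX K' ((Units.map (tf.ratFnFunctor.map t.op).hom).comp c₀) hinj
          hinvc hinvp).unitsToBirat
          (ofConnectedTemperoidData h Q odd_l R ιX K' ((Units.map (tf.ratFnFunctor.map t.op).hom).comp c₀) hinj
            hinvc hinvp).BN u ∈
        (ofConnectedTemperoidData h Q odd_l R ιX K' ((Units.map (tf.ratFnFunctor.map t.op).hom).comp c₀) hinj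
          hinvc hinvp).constEmb.range) :
    (ofConnectedTemperoidData h Q odd_l R ιX K' ((Units.map (tf.ratFnFunctor.map t.op).hom).comp c₀) hinj
      hinvc hinvp).Facts :=
  facts_ofConnectedTemperoidData h Q odd_l R ιX K' _ hinj hinvc hinvp hH
    (tf.biratAutModel_unitsMap_comp_apply_of_subsingleton R.BN t c₀) hgc

end General

section Ydd

variable {K : Type u₀} [Field K] {X : SemiGraphs.TemperedArithmeticGroup.{u₀} K} {D₀ : Type u₀} [Category.{v₀} D₀]
  {V : FrdIMonoidStub.{w}} {T₀ : RealifiedDivisorMonoids (D₀ := D₀) V}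
  {VD : FrdICatStub.{u₀ + 1, u₀, w} (ConnectedPart (BTemp X.Pi))}
  {tf : TemperedFrobenioid T₀ (ConnectedPart (BTemp X.Pi)) VD} {hZ : tf.monoidType = MonoidType.Z}
  {hP : ∀ A : (ConnectedPart (BTemp X.Pi))ᵒᵖ, IsPerfect (tf.Φ.carrier A)}
  {NH : Subgroup (Field.absoluteGaloisGroup K) → tf.category → ℕ+ → Prop}
  {lv N : ℕ+} {T : ThetaEnvData.{max u₀ w} N} {ιX : T.PiX ≃ₜ* X.Pi}
  {pullFrac : ∀ {A A' : (BiKummerSetting.mkOfConnectedTemperoidYdd X tf hZ hP NH T ιX).C} (_ : A' ⟶ A),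
    (BiKummerSetting.mkOfConnectedTemperoidYdd X tf hZ hP NH T ιX).biratUnits A →
      (BiKummerSetting.mkOfConnectedTemperoidYdd X tf hZ hP NH T ιX).biratUnits A'}
  {θ : (BiKummerSetting.mkOfConnectedTemperoidYdd X tf hZ hP NH T ιX).biratUnits
    (BiKummerSetting.mkOfConnectedTemperoidYdd X tf hZ hP NH T ιX).Aodot}
  {Bl : (BiKummerSetting.mkOfConnectedTemperoidYdd X tf hZ hP NH T ιX).C}
  {Pl : (BiKummerSetting.mkOfConnectedTemperoidYdd X tf hZ hP NH T ιX).FractionPair θ Bl}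
  {Rl : (BiKummerSetting.mkOfConnectedTemperoidYdd X tf hZ hP NH T ιX).NthRoot θ Pl lv pullFrac}
  (h : ModelFrobenioid.Hypotheses tf.divisorMonoid tf.ratFnFunctor)
  (Q : FrobenioidTheta.ThetaSubquotientStub.{w} (ConnectedPart (BTemp X.Pi))) (odd_l : Odd (lv : ℕ))
  (R : (BiKummerSetting.mkOfConnectedTemperoidYdd X tf hZ hP NH T ιX).NthRoot Rl.root Rl.pair N pullFrac)
  (K' : Type w) [Field K']
  {X₀ : ConnectedPart (BTemp X.Pi)} [Subsingleton (R.BN.base ⟶ X₀)] (t : R.BN.base ⟶ X₀)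
  (c₀ : K'ˣ →* (tf.ratFnFunctor.obj (op X₀))ˣ)
  (hinj : Function.Injective ((Units.map (tf.ratFnFunctor.map t.op).hom).comp c₀))
  (hinvc : ∀ g : Aut R.AN.base,
    pull tf.divisorMonoid g.hom (ModelFrobenioid.div R.pair.num) = ModelFrobenioid.div R.pair.num)
  (hinvp : ∀ y : T.PiX, y ∈ T.PiYdd →
    pull tf.divisorMonoid ((BiKummerSetting.mkOfConnectedTemperoidYdd X tf hZ hP NH T ιX).galoisSurj R.AN.base
      R.αData.isGalois (ιX y)).hom (ModelFrobenioid.div R.pair.den) = ModelFrobenioid.div R.pair.den)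

/-- **`Facts` for the §5 data over `B^temp(Π^tp_X)⁰` with `A_⊙^bs := Ÿ` and the constants pulled back from `X₀`, from `hgc`
(Lemma 5.8's geometric connectedness) ALONE**: abc-iut-L2-t4's `facts_ofConnectedTemperoidYddData` (`hH` a theorem) with
`hconst` (Def. 3.6 (iii), G-L2t4-3) DISCHARGED for `constEmb := B(t)^× ∘ c₀`.
[cite: MochizukiEtTh2009, §5 p.330–331 (PDF pp.104–105); Def 3.6 (iii) p.303 (PDF p.77); Lem 5.8 p.331 (PDF p.105)] -/
theorem facts_ofConnectedTemperoidYddData_ofSubsingleton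
    (hgc : ∀ u : (ofConnectedTemperoidData h Q odd_l R ιX K' ((Units.map (tf.ratFnFunctor.map t.op).hom).comp c₀) hinj
          hinvc hinvp).units
        (ofConnectedTemperoidData h Q odd_l R ιX K' ((Units.map (tf.ratFnFunctor.map t.op).hom).comp c₀) hinj
          hinvc hinvp).BN,
      (∀ y ∈ (ofConnectedTemperoidData h Q odd_l R ιX K' ((Units.map (tf.ratFnFunctor.map t.op).hom).comp c₀) hinj
          hinvc hinvp).imPiY,
        (ofConnectedTemperoidData h Q odd_l R ιX K' ((Units.map (tf.ratFnFunctor.map t.op).hom).comp c₀) hinj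
            hinvc hinvp).sgpCap y *
          (u : Aut (ofConnectedTemperoidData h Q odd_l R ιX K' ((Units.map (tf.ratFnFunctor.map t.op).hom).comp c₀)
            hinj hinvc hinvp).BN) *
          ((ofConnectedTemperoidData h Q odd_l R ιX K' ((Units.map (tf.ratFnFunctor.map t.op).hom).comp c₀) hinj
            hinvc hinvp).sgpCap y)⁻¹ = u) →
      (ofConnectedTemperoidData h Q odd_l R ιX K' ((Units.map (tf.ratFnFunctor.map t.op).hom).comp c₀) hinj
          hinvc hinvp).unitsToBirat
          (ofConnectedTemperoidData h Q odd_l R ιX K' ((Units.map (tf.ratFnFunctor.map t.op).hom).comp c₀) hinj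
            hinvc hinvp).BN u ∈
        (ofConnectedTemperoidData h Q odd_l R ιX K' ((Units.map (tf.ratFnFunctor.map t.op).hom).comp c₀) hinj
          hinvc hinvp).constEmb.range) :
    (ofConnectedTemperoidData h Q odd_l R ιX K' ((Units.map (tf.ratFnFunctor.map t.op).hom).comp c₀) hinj
      hinvc hinvp).Facts :=
  facts_ofConnectedTemperoidData_ofSubsingleton h Q odd_l R ιX K' t c₀ hinj hinvc hinvp
    (BiKummerSetting.hH_mkOfConnectedTemperoidYdd X tf hZ hP NH T ιX) hgc

end Ydd

end ThetaFrobenioid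

end Literature.AnabelianGeometry.EtaleTheta

end
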